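import Literature.Geometry.Lorentzian.CoordEntropyEvolution
import Literature.Geometry.Lorentzian.CoordConjugateHeat
import Literature.Geometry.Lorentzian.CoordCylinderFunctional
import Literature.Geometry.Lorentzian.CoordEnergyEvolution
import HarnessLib

/-!
# The evolution of `|∇v|²` for `∂ₜv = Δv − ½v|∇v|²` along a GENERAL metric family, in
# coordinates (Bamler 2020a, §4.2, proof of Thm. 4.1, with the `(∂ₜg + 2Ric)`-term kept)

Bamler's proof of the gradient estimate (2020a, Thm. 4.1) computes, for a heat solution
`u ∈ (0,1)` and `v = Φ⁻¹ ∘ u` (which solves `∂ₜv = Δv − ½ v|∇v|²`), the evolution of `w = |∇v|²`;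
on a (super) Ricci flow the Bochner term `2Ric(∇v,∇v)` cancels against `∂ₜg⁻¹`. The tree has this
for the Ricci flow in coordinates (`tDerivFun_gradSqAt_eq_of_halfFlow`,
`BamlerGradientEstimate.lean`). This file records the same computation for an ARBITRARY smooth
one-parameter family of metric components `G` on `V × S` (`MetricCoord.IsMetricFamilyOn`), where
the extra term survives:

* `IsMetricFamilyOn.tDerivFun_gradSqAt_eq_of_halfFlow_family` —
  `∂ₜ w = Δ w − 2|Hess v|² − w² − v · Dw(♯Dv) − h(♯Dv, ♯Dv) − 2 Ric(♯Dv, ♯Dv)`, `h = ∂ₜG`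
  (`hasDerivWithinAt_gradSqAt`: `∂ₜ|∇f|² = −h(♯Df,♯Df) + 2Dḟ(♯Df)`; Bochner `lapAt_gradSqAt`);
* `IsMetricFamilyOn.tDerivFun_gradSqAt_le_of_halfFlow_family` — dropping `−2|Hess v|² ≤ 0` at a
  point where `G t x` is positive definite;
* `exists_le_mul_of_continuousOn_of_posDef` — a continuous family of quadratic forms is bounded by
  a constant multiple of a continuous positive definite one on a compact parameter set;
* `IsMetricFamilyOn.exists_bound_tDeriv_ricAt` — hence, on a compact `K × S` on which the family is
  positive definite, `−h(η, η) − 2 Ric(η, η) ≤ C · G(η, η)`: the extra term is `≤ C w`.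

Everything is proved; no definitions, no named facts.

## References

* R. H. Bamler, *Entropy and heat kernel bounds on a Ricci flow background*, arXiv:2008.07093
  (2020), §4.2, proof of Thm. 4.1. [Bamler2020Entropy]
* P. Topping, *Lectures on the Ricci flow*, LMS Lecture Note Series 325 (2006), proof of
  Prop. 6.2.1 (`∂ₜ|∇f|² = −h(∇f,∇f) + 2⟨∇ḟ,∇f⟩`), proof of Prop. 8.2.6 (Bochner). [Topping2006]
-/

noncomputable section

open Set Filter Function Module Metric
open scoped Topology ContDiff

namespace Literature.Geometry.Lorentzian

namespace MetricCoord

/-! ### A continuous quadratic form is bounded by a positive definite one on compacta -/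

section QuadraticBound

variable {E : Type*} [NormedAddCommGroup E] [NormedSpace ℝ E] [FiniteDimensional ℝ E]
  {P : Type*} [TopologicalSpace P]

/-- **`B(η, η) ≤ C · G(η, η)` on a compact parameter set**: if `B, G : P → (E →L E →L ℝ)` are
continuous on a compact `K` and `G q` is positive definite for `q ∈ K`, there is `C ≥ 0` with
`B q η η ≤ C * G q η η` for all `q ∈ K`, `η : E` (continuity on the compact `K × unit sphere`,
homogeneity). [folklore] -/
theorem exists_le_mul_of_continuousOn_of_posDef {K : Set P} (hK : IsCompact K)
    {B G : P → E →L[ℝ] E →L[ℝ] ℝ} (hB : ContinuousOn B K) (hG : ContinuousOn G K)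
    (hpos : ∀ q ∈ K, ∀ η : E, η ≠ 0 → 0 < G q η η) :
    ∃ C : ℝ, 0 ≤ C ∧ ∀ q ∈ K, ∀ η : E, B q η η ≤ C * G q η η := by
  -- the compact set `K × sphere 0 1`
  set Q : Set (P × E) := K ×ˢ sphere (0 : E) 1 with hQ
  have hQc : IsCompact Q := hK.prod (isCompact_sphere 0 1)
  have hBc : ContinuousOn (fun z : P × E ↦ B z.1 z.2 z.2) Q := by
    have h1 : ContinuousOn (fun z : P × E ↦ B z.1) Q := hB.comp continuous_fst.continuousOn
      fun z hz ↦ hz.1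
    exact (h1.clm_apply continuous_snd.continuousOn).clm_apply continuous_snd.continuousOn
  have hGc : ContinuousOn (fun z : P × E ↦ G z.1 z.2 z.2) Q := by
    have h1 : ContinuousOn (fun z : P × E ↦ G z.1) Q := hG.comp continuous_fst.continuousOn
      fun z hz ↦ hz.1
    exact (h1.clm_apply continuous_snd.continuousOn).clm_apply continuous_snd.continuousOn
  rcases Q.eq_empty_or_nonempty with hQe | hQne
  · -- no unit vectors over `K`: either `K = ∅` or `E = 0`; `C = 0` works
    refine ⟨0, le_rfl, fun q hq η ↦ ?_⟩
    by_cases hη : η = 0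
    · simp [hη]
    · exfalso
      have hmem : (q, (‖η‖⁻¹ : ℝ) • η) ∈ Q := by
        refine ⟨hq, ?_⟩
        rw [mem_sphere_zero_iff_norm, norm_smul, norm_inv, norm_norm,
          inv_mul_cancel₀ (norm_ne_zero_iff.2 hη)]
      rw [hQe] at hmem
      exact hmem
  obtain ⟨zm, hzm, hmin⟩ := hQc.exists_isMinOn hQne hGc
  obtain ⟨zM, hzM, hmax⟩ := hQc.exists_isMaxOn hQne hBc
  set mG : ℝ := G zm.1 zm.2 zm.2 with hmG
  set bB : ℝ := B zM.1 zM.2 zM.2 with hbB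
  have hmGpos : 0 < mG := by
    have hne : zm.2 ≠ 0 := by
      intro h0
      have := hzm.2
      rw [mem_sphere_zero_iff_norm, h0, norm_zero] at this
      exact zero_ne_one this
    exact hpos zm.1 hzm.1 zm.2 hne
  refine ⟨max bB 0 / mG, div_nonneg (le_max_right _ _) hmGpos.le, fun q hq η ↦ ?_⟩
  by_cases hη : η = 0
  · simp [hη]
  -- normalise `η`
  have hrpos : 0 < ‖η‖ := norm_pos_iff.2 hη
  obtain ⟨ξ, hξ1, hηξ⟩ : ∃ ξ : E, ‖ξ‖ = 1 ∧ η = ‖η‖ • ξ := by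
    refine ⟨‖η‖⁻¹ • η, ?_, ?_⟩
    · rw [norm_smul, norm_inv, norm_norm, inv_mul_cancel₀ hrpos.ne']
    · rw [smul_smul, mul_inv_cancel₀ hrpos.ne', one_smul]
  have hξmem : (q, ξ) ∈ Q := ⟨hq, by rw [mem_sphere_zero_iff_norm]; exact hξ1⟩
  have hBξ : B q ξ ξ ≤ max bB 0 := (isMaxOn_iff.1 hmax (q, ξ) hξmem).trans (le_max_left _ _)
  have hGξ : mG ≤ G q ξ ξ := isMinOn_iff.1 hmin (q, ξ) hξmem
  have hscale : ∀ T : E →L[ℝ] E →L[ℝ] ℝ, T η η = ‖η‖ ^ 2 * T ξ ξ := by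
    intro T
    rw [hηξ, map_smul, map_smul]
    simp only [FunLike.coe_smul, Pi.smul_apply, smul_eq_mul, norm_smul,
      Real.norm_eq_abs, abs_norm, hξ1, mul_one]
    ring
  rw [hscale (B q), hscale (G q)]
  have h1 : B q ξ ξ ≤ max bB 0 / mG * G q ξ ξ := by
    calc B q ξ ξ ≤ max bB 0 := hBξ
      _ = max bB 0 / mG * mG := by field_simp
      _ ≤ max bB 0 / mG * G q ξ ξ :=
        mul_le_mul_of_nonneg_left hGξ (div_nonneg (le_max_right _ _) hmGpos.le)
  nlinarith [sq_nonneg ‖η‖]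

end QuadraticBound

/-! ### The evolution of `|∇v|²` along a general family -/

namespace IsMetricFamilyOn

variable {E : Type*} [NormedAddCommGroup E] [NormedSpace ℝ E] [FiniteDimensional ℝ E]
  [CompleteSpace E] {G : ℝ → E → E →L[ℝ] E →L[ℝ] ℝ} {S : Set ℝ} {V : Set E} {x : E} {t : ℝ}
  {v : ℝ → E → ℝ}

variable (hG : IsMetricFamilyOn G S V)
include hG

/-- **The evolution of `w = |∇v|²` for `∂ₜv = Δv − ½v|∇v|²` along a general smooth family of
metric components** (Bamler 2020a, proof of Thm. 4.1, with the `(∂ₜg + 2 Ric)`-term kept): for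
`v` `C^∞` on `V × S` solving at time `t` on `V` the equation `∂ₜv = Δv − ½ v |∇v|²`, at `x ∈ V`,
with `h = ∂ₜG` (`tDeriv`) and `♯Dv` the gradient,

  `∂ₜ w = Δ w − 2|Hess v|² − w² − v · Dw(♯Dv) − h(♯Dv, ♯Dv) − 2 Ric(♯Dv, ♯Dv)`

(`hasDerivWithinAt_gradSqAt`: `∂ₜ|∇v|² = −h(♯Dv,♯Dv) + 2Dv̇(♯Dv)`; the Bochner formula
`lapAt_gradSqAt`; `⟨∇v, ∇(−½ v w)⟩ = −½ w² − ½ v⟨∇v,∇w⟩`).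
[cite: Bamler2020Entropy, §4.2, proof of Thm. 4.1] [cite: Topping2006, proof of Prop. 6.2.1] -/
theorem tDerivFun_gradSqAt_eq_of_halfFlow_family
    (hv : ContDiffOn ℝ ∞ (fun p : E × ℝ ↦ v p.2 p.1) (V ×ˢ S)) (hx : x ∈ V) (ht : t ∈ S)
    (hveq : ∀ y ∈ V, tDerivFun v S t y =
      lapAt (G t) (v t) y - 2⁻¹ * v t y * gradSqAt (G t) (v t) y) :
    tDerivFun (fun s y ↦ gradSqAt (G s) (v s) y) S t x =
      lapAt (G t) (gradSqAt (G t) (v t)) x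
        - 2 * normSqAt (G t) x (hessAt (G t) (v t) x)
        - gradSqAt (G t) (v t) x ^ 2
        - v t x * fderiv ℝ (gradSqAt (G t) (v t)) x (sharpAt (G t) x (fderiv ℝ (v t) x))
        - tDeriv G S t x (sharpAt (G t) x (fderiv ℝ (v t) x)) (sharpAt (G t) x (fderiv ℝ (v t) x))
        - 2 * ricAt (G t) x (sharpAt (G t) x (fderiv ℝ (v t) x))
            (sharpAt (G t) x (fderiv ℝ (v t) x)) := by
  have hGt := hG.isMetricOn t ht
  have hVo : IsOpen V := hG.isOpen ht
  have hvt : ContDiffOn ℝ ∞ (v t) V := contDiffOn_of_family hv ht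
  -- the time derivative of `|∇v|²` along the family
  have hd := (hG.hasDerivWithinAt_gradSqAt hv hx ht).derivWithin (hG.uniqueDiffOn t ht)
  set w : E → ℝ := gradSqAt (G t) (v t) with hw
  have hΔ : ContDiffOn ℝ ∞ (lapAt (G t) (v t)) V := hGt.contDiffOn_lapAt hvt
  have hwV : ContDiffOn ℝ ∞ w V := hGt.contDiffOn_gradSqAt hvt
  have hΔd : DifferentiableAt ℝ (lapAt (G t) (v t)) x :=
    (contDiffAt_of_contDiffOn hVo hΔ hx).differentiableAt (by simp)
  have hwd : DifferentiableAt ℝ w x :=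
    (contDiffAt_of_contDiffOn hVo hwV hx).differentiableAt (by simp)
  have hvd : DifferentiableAt ℝ (v t) x :=
    (contDiffAt_of_contDiffOn hVo hvt hx).differentiableAt (by simp)
  -- `D v̇ = D(Δ v) − ½ v Dw − ½ w Dv` at `x`
  have hweq : tDerivFun v S t =ᶠ[𝓝 x] fun y ↦ lapAt (G t) (v t) y - 2⁻¹ * v t y * w y := by
    filter_upwards [hVo.mem_nhds hx] with y hy using hveq y hy
  have hprod : HasFDerivAt (fun y ↦ 2⁻¹ * v t y * w y)
      ((2⁻¹ * v t x) • fderiv ℝ w x + w x • ((2⁻¹ : ℝ) • fderiv ℝ (v t) x)) x :=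
    (hvd.hasFDerivAt.const_mul 2⁻¹).mul hwd.hasFDerivAt
  have hrhs : HasFDerivAt (fun y ↦ lapAt (G t) (v t) y - 2⁻¹ * v t y * w y)
      (fderiv ℝ (lapAt (G t) (v t)) x
        - ((2⁻¹ * v t x) • fderiv ℝ w x + w x • ((2⁻¹ : ℝ) • fderiv ℝ (v t) x))) x :=
    hΔd.hasFDerivAt.sub hprod
  have hD : fderiv ℝ (tDerivFun v S t) x = fderiv ℝ (lapAt (G t) (v t)) x
      - ((2⁻¹ * v t x) • fderiv ℝ w x + w x • ((2⁻¹ : ℝ) • fderiv ℝ (v t) x)) := by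
    rw [hweq.fderiv_eq, hrhs.fderiv]
  -- the Bochner formula
  have hB := hGt.lapAt_gradSqAt hx hvt
  have hww : fderiv ℝ (v t) x (sharpAt (G t) x (fderiv ℝ (v t) x)) = w x := rfl
  change derivWithin (fun s ↦ gradSqAt (G s) (v s) x) S t = _
  rw [hd, hD, hB]
  simp only [_root_.sub_apply, _root_.add_apply, _root_.smul_apply, smul_eq_mul, hww, neg_add_eq_sub]
  ring

/-- **The differential inequality for `|∇v|²` along a general family**: under the hypotheses of
`tDerivFun_gradSqAt_eq_of_halfFlow_family`, if `G t x` is positive definite then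

  `∂ₜ w ≤ Δ w − w² − v · Dw(♯Dv) − h(♯Dv, ♯Dv) − 2 Ric(♯Dv, ♯Dv)`

(drop `−2|Hess v|² ≤ 0`, `normSqAt_nonneg_of_posDef`).
[cite: Bamler2020Entropy, §4.2, proof of Thm. 4.1] -/
theorem tDerivFun_gradSqAt_le_of_halfFlow_family
    (hv : ContDiffOn ℝ ∞ (fun p : E × ℝ ↦ v p.2 p.1) (V ×ˢ S)) (hx : x ∈ V) (ht : t ∈ S)
    (hveq : ∀ y ∈ V, tDerivFun v S t y =
      lapAt (G t) (v t) y - 2⁻¹ * v t y * gradSqAt (G t) (v t) y)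
    (hposdef : ∀ e : E, e ≠ 0 → 0 < G t x e e) :
    tDerivFun (fun s y ↦ gradSqAt (G s) (v s) y) S t x ≤
      lapAt (G t) (gradSqAt (G t) (v t)) x
        - gradSqAt (G t) (v t) x ^ 2
        - v t x * fderiv ℝ (gradSqAt (G t) (v t)) x (sharpAt (G t) x (fderiv ℝ (v t) x))
        - tDeriv G S t x (sharpAt (G t) x (fderiv ℝ (v t) x)) (sharpAt (G t) x (fderiv ℝ (v t) x))
        - 2 * ricAt (G t) x (sharpAt (G t) x (fderiv ℝ (v t) x))
            (sharpAt (G t) x (fderiv ℝ (v t) x)) := by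
  rw [hG.tDerivFun_gradSqAt_eq_of_halfFlow_family hv hx ht hveq]
  have hn := normSqAt_nonneg_of_posDef ((hG.isMetricOn t ht).symm x hx) hposdef
    (hessAt (G t) (v t) x)
  linarith

omit [CompleteSpace E] in
/-- **The extra term is bounded by `C |∇v|²` on compacta**: on a compact `K × S'` inside `V × S`
on which the family is positive definite there is `C ≥ 0` with
`−h(η, η) − 2 Ric(η, η) ≤ C · G(η, η)` for all `η` (`h = ∂ₜG` and `Ric` are continuous on
`V × S`, `contDiffOn_tDeriv_uncurry`, `contDiffOn_ricAt_family`;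
`exists_le_mul_of_continuousOn_of_posDef`). [folklore] -/
theorem exists_bound_tDeriv_ricAt {K : Set E} (hK : IsCompact K) (hKV : K ⊆ V) {S' : Set ℝ}
    (hS' : IsCompact S') (hS'S : S' ⊆ S)
    (hpos : ∀ s ∈ S', ∀ y ∈ K, ∀ e : E, e ≠ 0 → 0 < G s y e e) :
    ∃ C : ℝ, 0 ≤ C ∧ ∀ s ∈ S', ∀ y ∈ K, ∀ η : E,
      -tDeriv G S s y η η - 2 * ricAt (G s) y η η ≤ C * G s y η η := by
  have hsub : K ×ˢ S' ⊆ V ×ˢ S := prod_mono hKV hS'S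
  have hBc : ContinuousOn (fun q : E × ℝ ↦ -tDeriv G S q.2 q.1 - (2 : ℝ) • ricAt (G q.2) q.1)
      (K ×ˢ S') :=
    ((hG.contDiffOn_tDeriv_uncurry.neg).sub
      (hG.contDiffOn_ricAt_family.const_smul (2 : ℝ))).continuousOn.mono hsub
  have hGc : ContinuousOn (fun q : E × ℝ ↦ G q.2 q.1) (K ×ˢ S') :=
    hG.contDiffOn.continuousOn.mono hsub
  obtain ⟨C, hC0, hC⟩ := exists_le_mul_of_continuousOn_of_posDef (hK.prod hS')
    (B := fun q : E × ℝ ↦ -tDeriv G S q.2 q.1 - (2 : ℝ) • ricAt (G q.2) q.1)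
    (G := fun q : E × ℝ ↦ G q.2 q.1) hBc hGc (fun q hq η hη ↦ hpos q.2 hq.2 q.1 hq.1 η hη)
  refine ⟨C, hC0, fun s hs y hy η ↦ ?_⟩
  have h1 := hC (y, s) ⟨hy, hs⟩ η
  simp only [_root_.sub_apply, _root_.neg_apply, _root_.smul_apply, smul_eq_mul] at h1
  linarith

end IsMetricFamilyOn

end MetricCoord

end Literature.Geometry.Lorentzian

end
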